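import Summits.HodgeConjecture.HodgeConjecture.Theorems.NikulinTwinTransportTwinSimilitudeAlgebraicTransfer

/-!
# Route NikulinTwinTransport · crux `HodgeSimilitudeAlgebraic` (stmt-HodgeConjecture-13676) —
# anchors from twin transport, at every multiplier

The crux (ALL multipliers `r > 0`) is reduced by `hodgeSimilitudeAlgebraic_of_prime_anchors`
(file `NikulinTwinTransportHodgeSimilitudeAlgebraicPrimes`) to Buskin's theorem, the composition of
algebraic correspondences and, for every prime `q`, an ALGEBRAIC ANCHOR `q`-SIMILITUDE for every
projective K3 surface `S` (`AnchorAt[q]`: a projective K3 partner `S″` and an algebraic `ℂ`-linear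
equivalence `Ψ : H²(S″) ≃ H²(S)` whose inverse is a rational, type-preserving `q⁻¹`-similitude).
The route's plan produces anchors by "one anchor per prime … each transported as in
TwinTwistorTransport". This file proves, for an ARBITRARY rational multiplier `c > 0`, that the
twin-transport deliverable gives the anchors, and conversely:

* `periodPt_simil`: a rational `e`-similitude (`e > 0` rational) of `Λ_ℂ` carries projective
  period points to projective period points (generalises `periodPt_twin`, `e = ½`).
* `anchorAt_of_twinTransport`: granted the K3 facts `Huybrechts_K3_periodSurjective_projective`,
  `Huybrechts_K3_marking_exists`, `Huybrechts_K3_hodgeTypes_H2`, ONE `ℂ`-linear `c`-similitude `M`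
  of `(Λ_ℂ, k3Form)` defined over `ℚ` with a two-sided inverse `N` over `ℚ` whose twin similitude
  `η⁻¹ ∘ M ∘ η″` is algebraic on every `M`-twin pair of marked projective K3 surfaces yields
  `AnchorAt[c]`: mark `S` by `(η, p₀, x)`; the twin period `N x` is a projective period point,
  realised by a marked projective `(S″, η″)`; `Ψ = η⁻¹ M η″` is algebraic by the twin transport and
  `Ψ⁻¹ = η″⁻¹ N η` is rational, type-preserving and divides the form by `c` (first half of the
  proof of `twinSimilitudeAlgebraic_of_twinTransport`, now for any `c`).
* `twinTransport_of_simAlgAt`: conversely the crux at multiplier `c` makes the twin similitude of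
  EVERY rational `c`-similitude `M` algebraic on every `M`-twin pair (as
  `twinTransport_of_twinSimilitudeAlgebraic`, `c = 2`).

With `exists_ratSimilitude_k3Lattice` (rational `n`-similitudes of `Λ` exist for all `n ≥ 1`) and
prime multipliers sufficing, the crux is thereby EQUIVALENT — modulo Buskin (item 13675), the
three K3 facts and the composition of correspondences — to: for every prime `q`, twin transport
for one rational `q`-similitude of the K3 lattice. Nothing here proves any twin transport.
-/

noncomputable section

open CategoryTheory MonoidalCategory
open scoped Manifold
open Literature.AlgebraicGeometry.Motives Literature.AlgebraicGeometry.HodgeTheory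
open Literature.AlgebraicGeometry.Surfaces Literature.Geometry.Kaehler
open Literature.AlgebraicTopology.SingularHomology

namespace Summit.HodgeConjecture.HodgeConjecture.Theorems.NikulinTwinTransport

/-! ### Local notations (verbatim those of the Transfer and Primes files) -/

/-- `MarkedK3[S, η, p, x]`: a marked K3 surface with period `x` (shape of the K3 facts). Local
notation only, verbatim from `NikulinTwinTransportTwinSimilitudeAlgebraicTransfer`. -/
local notation3 (prettyPrint := false) "MarkedK3[" S ", " η ", " p ", " x "]" =>
  (IsIntegralClass p ∧
    (∀ q : complexBetti S (2 * 2), IsIntegralClass q → ∃ n : ℤ, q = n • p) ∧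
    (∀ c : complexBetti S (2 * 1), IsIntegralClass c ↔ ∃ v : K3Index → ℤ, η c = fun i => (v i : ℂ)) ∧
    (∀ a b : complexBetti S (2 * 1),
        cupProduct (rfl : 2 * 1 + 2 * 1 = 2 * 2) a b = k3Form (η a) (η b) • p) ∧
    IsOfHodgeType 2 S (2 * 1) 2 0 (LinearEquiv.symm η x) ∧
    (∀ τ : complexBetti S (2 * 1), IsOfHodgeType 2 S (2 * 1) 2 0 τ → ∃ t : ℂ, τ = t • LinearEquiv.symm η x))

/-- `PeriodPt[x]`: a projective period point. Local notation only, verbatim from the Transfer file. -/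
local notation3 (prettyPrint := false) "PeriodPt[" x "]" =>
  (k3Form x x = 0 ∧ 0 < (k3Form (star x) x).re ∧
    ∃ u : K3Index → ℤ, k3Form (fun i => (u i : ℂ)) x = 0 ∧ 0 < ∑ i, ∑ j, u i * k3Gram i j * u j)

/-- `Corr[μ, S, S', hS, hS' ; γ, y] = [γ]_* y`. Local notation only, verbatim from the Transfer file. -/
local notation3 (prettyPrint := false) "Corr[" μ ", " S ", " S' ", " hS ", " hS' " ; " γ ", " y "]" =>
  complexGysin μ
    (IsSmoothProjective.tensor_holds (IsK3Surface.isSmoothProjective hS)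
      (IsK3Surface.isSmoothProjective hS'))
    (IsK3Surface.isSmoothProjective hS) (SemiCartesianMonoidalCategory.fst S S')
    (rfl : 2 * 1 + 2 * 2 + 2 * 2 = 2 * 1 + 2 * (2 + 2))
    (cupProduct (rfl : 2 * 1 + 2 * 2 = 2 * 1 + 2 * 2)
      (complexBetti.map (SemiCartesianMonoidalCategory.snd S S') (2 * 1) y) γ)

/-- `TwinTransportFor[M]`: THE TWIN TRANSPORT for the endomorphism `M` of `Λ_ℂ` — on every pair of
marked projective K3 surfaces whose periods correspond under `M`, the twin similitude
`η⁻¹ ∘ M ∘ η'` is induced by an algebraic class (verbatim the hypothesis `htw` of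
`twinSimilitudeAlgebraic_of_twinTransport`). Local notation only. -/
local notation3 (prettyPrint := false) "TwinTransportFor[" M "]" =>
  ∀ (μ : OrientationFamily), μ.HasPoincareDuality →
    ∀ (S S' : SchemeOver ℂ) (hS : IsK3Surface S) (hS' : IsK3Surface S')
      (η : complexBetti S (2 * 1) ≃ₗ[ℂ] (K3Index → ℂ)) (p : complexBetti S (2 * 2))
      (x : K3Index → ℂ)
      (η' : complexBetti S' (2 * 1) ≃ₗ[ℂ] (K3Index → ℂ)) (p' : complexBetti S' (2 * 2))
      (x' : K3Index → ℂ),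
      MarkedK3[S, η, p, x] → PeriodPt[x] → MarkedK3[S', η', p', x'] → PeriodPt[x'] →
      (∃ t : ℂ, M x' = t • x) →
      ∃ γ ∈ algebraicClasses (MonoidalCategoryStruct.tensorObj S S') 2,
        ∀ y : complexBetti S' (2 * 1), η.symm (M (η' y)) = Corr[μ, S, S', hS, hS' ; γ, y]

/-- `SimAlgAt[c]`: the crux at one multiplier `c : ℂ`. Local notation only, verbatim from
`NikulinTwinTransportHodgeSimilitudeAlgebraicPrimes`. -/
local notation3 (prettyPrint := false) "SimAlgAt[" c "]" =>
  ∀ (μ : OrientationFamily), μ.HasPoincareDuality →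
    ∀ (S S' : SchemeOver ℂ)
      (hS : (IsSmoothProjective 2 S ∧ Subsingleton (structureSheafCohomology S.left 1) ∧
        ∃ (A : HodgeModel 2 S) (η : MForm 𝓘(ℝ, A.model) A.carrier ℂ 2),
          IsHolomorphicInCharts η ∧ ∀ x, η x ≠ 0))
      (hS' : (IsSmoothProjective 2 S' ∧ Subsingleton (structureSheafCohomology S'.left 1) ∧
        ∃ (A : HodgeModel 2 S') (η : MForm 𝓘(ℝ, A.model) A.carrier ℂ 2),
          IsHolomorphicInCharts η ∧ ∀ x, η x ≠ 0))
      (p : complexBetti S (2 * 2)) (p' : complexBetti S' (2 * 2)),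
      (IsIntegralClass p ∧ ∀ q : complexBetti S (2 * 2), IsIntegralClass q → ∃ n : ℤ, q = n • p) →
      (IsIntegralClass p' ∧
        ∀ q : complexBetti S' (2 * 2), IsIntegralClass q → ∃ n : ℤ, q = n • p') →
      ∀ (ψ : complexBetti S' (2 * 1) →ₗ[ℂ] complexBetti S (2 * 1)),
        (∀ x, IsRationalClass x → IsRationalClass (ψ x)) →
        (∀ (i j : ℕ) x, IsOfHodgeType 2 S' (2 * 1) i j x → IsOfHodgeType 2 S (2 * 1) i j (ψ x)) →
        (∀ (x y : complexBetti S' (2 * 1)) (a : ℂ),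
          cupProduct (rfl : 2 * 1 + 2 * 1 = 2 * 2) x y = a • p' →
            cupProduct (rfl : 2 * 1 + 2 * 1 = 2 * 2) (ψ x) (ψ y) = (c * a) • p) →
        ∃ γ ∈ algebraicClasses (MonoidalCategoryStruct.tensorObj S S') 2,
          ∀ x : complexBetti S' (2 * 1),
            ψ x = complexGysin μ (IsSmoothProjective.tensor_holds hS.1 hS'.1) hS.1
              (SemiCartesianMonoidalCategory.fst S S')
              (rfl : 2 * 1 + 2 * 2 + 2 * 2 = 2 * 1 + 2 * (2 + 2))
              (cupProduct (rfl : 2 * 1 + 2 * 2 = 2 * 1 + 2 * 2)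
                (complexBetti.map (SemiCartesianMonoidalCategory.snd S S') (2 * 1) x) γ)

/-- `AnchorAt[c]`: an algebraic anchor `c`-similitude for every projective K3 surface. Local
notation only, verbatim from `NikulinTwinTransportHodgeSimilitudeAlgebraicPrimes`. -/
local notation3 (prettyPrint := false) "AnchorAt[" c "]" =>
  ∀ (μ : OrientationFamily), μ.HasPoincareDuality →
    ∀ (S : SchemeOver ℂ)
      (hS : (IsSmoothProjective 2 S ∧ Subsingleton (structureSheafCohomology S.left 1) ∧
        ∃ (A : HodgeModel 2 S) (η : MForm 𝓘(ℝ, A.model) A.carrier ℂ 2),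
          IsHolomorphicInCharts η ∧ ∀ x, η x ≠ 0))
      (p : complexBetti S (2 * 2)),
      (IsIntegralClass p ∧ ∀ q : complexBetti S (2 * 2), IsIntegralClass q → ∃ n : ℤ, q = n • p) →
      ∃ (S'' : SchemeOver ℂ)
        (hS'' : (IsSmoothProjective 2 S'' ∧ Subsingleton (structureSheafCohomology S''.left 1) ∧
          ∃ (A : HodgeModel 2 S'') (η : MForm 𝓘(ℝ, A.model) A.carrier ℂ 2),
            IsHolomorphicInCharts η ∧ ∀ x, η x ≠ 0))
        (p'' : complexBetti S'' (2 * 2)),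
        (IsIntegralClass p'' ∧
          ∀ q : complexBetti S'' (2 * 2), IsIntegralClass q → ∃ n : ℤ, q = n • p'') ∧
        ∃ Ψ : complexBetti S'' (2 * 1) ≃ₗ[ℂ] complexBetti S (2 * 1),
          (∀ y, IsRationalClass y → IsRationalClass (Ψ.symm y)) ∧
          (∀ (i j : ℕ) y, IsOfHodgeType 2 S (2 * 1) i j y →
            IsOfHodgeType 2 S'' (2 * 1) i j (Ψ.symm y)) ∧
          (∀ (u v : complexBetti S (2 * 1)) (b : ℂ),
            cupProduct (rfl : 2 * 1 + 2 * 1 = 2 * 2) u v = (c * b) • p →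
              cupProduct (rfl : 2 * 1 + 2 * 1 = 2 * 2) (Ψ.symm u) (Ψ.symm v) = b • p'') ∧
          ∃ γ ∈ algebraicClasses (MonoidalCategoryStruct.tensorObj S S'') 2,
            ∀ x : complexBetti S'' (2 * 1),
              Ψ x = complexGysin μ (IsSmoothProjective.tensor_holds hS.1 hS''.1) hS.1
                (SemiCartesianMonoidalCategory.fst S S'')
                (rfl : 2 * 1 + 2 * 2 + 2 * 2 = 2 * 1 + 2 * (2 + 2))
                (cupProduct (rfl : 2 * 1 + 2 * 2 = 2 * 1 + 2 * 2)
                  (complexBetti.map (SemiCartesianMonoidalCategory.snd S S'') (2 * 1) x) γ)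

/-! ### Similitudes carry projective period points to projective period points -/

/-- **A rational similitude of positive rational multiplier preserves projective period points.**
If `N` is an endomorphism of `Λ_ℂ` defined over `ℚ` with `(Na.Nb) = e (a.b)`, `e > 0` rational,
and `x` satisfies the hypotheses of `Huybrechts_K3_periodSurjective_projective`, then so does
`N x`: `N` is real, and a positive lattice vector `u ∈ x^⊥` goes to the positive rational vector
`N u ∈ (N x)^⊥`, a multiple of which lies in `Λ` (`exists_lattice_pos_orthogonal`).
[cite: Huybrechts2016K3, Ch. 6 Rem. 3.3 and Ch. 1 §3 (projectivity criterion)] -/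
theorem periodPt_simil (N : Module.End ℂ (K3Index → ℂ))
    (hNrat : ∀ v : K3Index → ℤ, ∃ w : K3Index → ℚ, N (fun i => (v i : ℂ)) = fun i => (w i : ℂ))
    (e : ℚ) (he : 0 < e) (hN : ∀ a b, k3Form (N a) (N b) = (e : ℂ) * k3Form a b) {x : K3Index → ℂ}
    (hx : PeriodPt[x]) : PeriodPt[N x] := by
  obtain ⟨hxx, hpos, u, hux, huu⟩ := hx
  refine ⟨by rw [hN, hxx, mul_zero], ?_, ?_⟩
  · rw [← ratEnd_star N hNrat x, hN, show ((e : ℚ) : ℂ) = ((e : ℝ) : ℂ) by norm_cast,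
      Complex.re_ofReal_mul]
    exact mul_pos (by exact_mod_cast he) hpos
  · obtain ⟨w, hw⟩ := hNrat u
    refine exists_lattice_pos_orthogonal (n := w) ?_ ?_
    · rw [← hw, hN, hux, mul_zero]
    · have h1 : ((k3FormRat w w : ℚ) : ℂ) =
          ((e * ((∑ i, ∑ j, u i * k3Gram i j * u j : ℤ) : ℚ) : ℚ) : ℂ) := by
        rw [← k3Form_ratCast, ← hw, hN, k3Form_intCast]
        push_cast
        ring
      rw [Rat.cast_injective h1]
      exact mul_pos he (Int.cast_pos.2 huu)

/-! ### Anchors from twin transport -/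

/-- **An algebraic anchor `c`-similitude for every projective K3 surface from ONE twin transport at
multiplier `c`.** Granted surjectivity of the period map (projective form), markings, the Hodge
types of `H²(K3)`, and a `ℂ`-linear `c`-similitude `M` of `(Λ_ℂ, k3Form)` (`c > 0` rational) defined
over `ℚ` with a two-sided inverse `N` defined over `ℚ` whose twin similitude `η⁻¹ ∘ M ∘ η″` is
algebraic on every `M`-twin pair of marked projective K3 surfaces, every projective K3 surface `S`
with integral generator `p` of `H⁴` has a projective K3 partner `S″` and an algebraic
`Ψ : H²(S″) ≃ H²(S)` whose inverse is rational, type-preserving and divides the cup form by `c`.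
Proof: mark `S` (`η, p₀, x`, `p = ±p₀`); `N x` is a projective period point (`periodPt_simil`,
multiplier `c⁻¹`), realised by a marked projective `(S″, η″, p″)`; `Ψ = η⁻¹ ∘ M ∘ η″` is algebraic
by the twin transport (period condition `M N x = x`); `Ψ⁻¹ = η″⁻¹ ∘ N ∘ η` is rational
(`isRationalClass_markingConj`), preserves all Hodge types (`isOfHodgeType_markingConj`) and
divides the form by `c` (`cupProduct_markingConj`, generator `±p″`).
[cite: Buskin2019, §6.2] [cite: Varesco2023, §2 (proof of Thm. 2.1)]
[cite: Huybrechts2016K3, Ch. 1 Prop. 3.5, Ch. 6 Prop. 1.2 and Rem. 3.3] -/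
theorem anchorAt_of_twinTransport (c : ℚ) (hc : 0 < c)
    (hP : Huybrechts_K3_periodSurjective_projective) (hMk : Huybrechts_K3_marking_exists)
    (hHT : Huybrechts_K3_hodgeTypes_H2)
    (M N : Module.End ℂ (K3Index → ℂ))
    (hNrat : ∀ v : K3Index → ℤ, ∃ w : K3Index → ℚ, N (fun i => (v i : ℂ)) = fun i => (w i : ℂ))
    (hMN : M * N = 1) (hNM : N * M = 1) (hMc : ∀ a b, k3Form (M a) (M b) = (c : ℂ) * k3Form a b)
    (htw : TwinTransportFor[M]) : AnchorAt[(c : ℂ)] := by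
  intro μ hμ S hS p hp
  have hSK : IsK3Surface S := hS
  have hc0 : (c : ℂ) ≠ 0 := by exact_mod_cast hc.ne'
  -- `N = M⁻¹` multiplies the form by `c⁻¹`
  have hNc : ∀ a b, k3Form (N a) (N b) = ((c⁻¹ : ℚ) : ℂ) * k3Form a b := fun a b => by
    have h := hMc (N a) (N b)
    rw [← Module.End.mul_apply (f := M), ← Module.End.mul_apply (f := M), hMN,
      Module.End.one_apply, Module.End.one_apply] at h
    rw [h, Rat.cast_inv, ← mul_assoc, inv_mul_cancel₀ hc0, one_mul]
  -- mark `S`; the generator `p` of the statement is `± p₀`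
  obtain ⟨η, p₀, x, hp₀, hm, hx⟩ := hMk S hSK
  have hsg : p = p₀ ∨ p = -p₀ := eq_or_eq_neg_of_zsmul hp₀ (hp.2 p₀ hm.1) (hm.2.1 p hp.1)
  obtain ⟨s, hs, hs1⟩ : ∃ s : ℂ, p = s • p₀ ∧ (s = 1 ∨ s = -1) := by
    rcases hsg with hsg | hsg
    · exact ⟨1, by rw [hsg, one_smul], Or.inl rfl⟩
    · exact ⟨-1, by rw [hsg, neg_one_smul], Or.inr rfl⟩
  -- the twin period `N x` and the twin surface `S''`
  have hx'' : PeriodPt[N x] := periodPt_simil N hNrat c⁻¹ (inv_pos.2 hc) hNc hx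
  obtain ⟨S'', hSK'', η'', p'', hm''⟩ := hP (N x) hx''.1 hx''.2.1 hx''.2.2
  have hper1 : ∃ t : ℂ, M (N x) = t • x :=
    ⟨1, by rw [← Module.End.mul_apply (f := M), hMN, Module.End.one_apply, one_smul]⟩
  have hper2 : ∃ t : ℂ, N x = t • N x := ⟨1, (one_smul _ _).symm⟩
  -- the twin similitude `Ψ = η⁻¹ ∘ M ∘ η''` is algebraic
  obtain ⟨γ, hγ, hγeq⟩ := htw μ hμ S S'' hSK hSK'' η p₀ x η'' p'' (N x) hm hx hm'' hx'' hper1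
  -- `Ψ` as a linear equivalence, with inverse `η''⁻¹ ∘ N ∘ η`
  let E : (K3Index → ℂ) ≃ₗ[ℂ] (K3Index → ℂ) :=
    LinearEquiv.ofLinear M N (by rw [← Module.End.mul_eq_comp, hMN, Module.End.one_eq_id])
      (by rw [← Module.End.mul_eq_comp, hNM, Module.End.one_eq_id])
  let Ψ : complexBetti S'' (2 * 1) ≃ₗ[ℂ] complexBetti S (2 * 1) := η''.trans (E.trans η.symm)
  have hΨ : ∀ y, Ψ y = η.symm (M (η'' y)) := fun y => rfl
  have hΨs : ∀ u, Ψ.symm u = η''.symm (N (η u)) := fun u => rfl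
  -- the generator `s • p''` of `H⁴(S'')` matching the sign of `p`
  have hq''int : IsIntegralClass (s • p'') := by
    rcases hs1 with rfl | rfl
    · rw [one_smul]
      exact hm''.1
    · have h := hm''.1.zsmul (-1)
      rwa [Int.cast_neg, Int.cast_one] at h
  have hq''gen : ∀ q : complexBetti S'' (2 * 2), IsIntegralClass q → ∃ n : ℤ, q = n • (s • p'') :=
    fun q hq => by
    obtain ⟨n, hn⟩ := hm''.2.1 q hq
    rcases hs1 with rfl | rfl
    · exact ⟨n, by rw [one_smul]; exact hn⟩
    · exact ⟨-n, by rw [hn, neg_one_smul, neg_smul, smul_neg, neg_neg]⟩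
  refine ⟨S'', hSK'', s • p'', ⟨hq''int, hq''gen⟩, Ψ, ?_, ?_, ?_, γ, hγ, fun y => ?_⟩
  · intro u hu
    rw [hΨs]
    exact isRationalClass_markingConj η'' η N hSK'' hSK hm''.2.2.1 hm.2.2.1 hNrat hu
  · intro i j u hu
    rw [hΨs]
    exact isOfHodgeType_markingConj η'' p'' (N x) η p₀ x N hHT hSK'' hSK hm''.2.2.1
      hm''.2.2.2.1 hm''.2.2.2.2.1 hx''.2.1 hm.2.2.1 hm.2.2.2.1 hp₀ hm.2.2.2.2.1 hx.2.1 hNrat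
      (by exact_mod_cast (inv_pos.2 hc).ne' : ((c⁻¹ : ℚ) : ℂ) ≠ 0) hNc hper2 i j u hu
  · intro u v b h
    rw [hΨs, hΨs]
    rw [hs, smul_smul] at h
    rw [cupProduct_markingConj η'' p'' η p₀ N hp₀ hm''.2.2.2.1 hm.2.2.2.1 hNc u v ((c : ℂ) * b * s) h,
      smul_smul]
    congr 1
    rw [Rat.cast_inv]
    calc ((c : ℂ))⁻¹ * ((c : ℂ) * b * s) = ((c : ℂ)⁻¹ * c) * b * s := by ring
      _ = b * s := by rw [inv_mul_cancel₀ hc0, one_mul]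
  · rw [hΨ]
    exact hγeq y

/-! ### Conversely: the crux at multiplier `c` gives every twin transport at multiplier `c` -/

/-- **The crux at multiplier `c` gives the twin transport for every rational `c`-similitude**
(generalising `twinTransport_of_twinSimilitudeAlgebraic`, `c = 2`): granted the Hodge types of
`H²(K3)`, if every rational, type-preserving `c`-similitude between projective K3 surfaces is
algebraic (`c ≠ 0`), then for every `ℂ`-linear `c`-similitude `M` of `(Λ_ℂ, k3Form)` defined over
`ℚ` and every pair of marked projective K3 surfaces whose periods correspond under `M`, the twin
similitude `η⁻¹ ∘ M ∘ η'` is `[γ]_*` for an algebraic `γ` (it is rational, type-preserving and a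
`c`-similitude for the generators of the markings). [cite: Buskin2019, §6.2]
[cite: Huybrechts2016K3, Ch. 6 Prop. 1.2 and Rem. 3.3] -/
theorem twinTransport_of_simAlgAt (c : ℚ) (hc : c ≠ 0) (hHT : Huybrechts_K3_hodgeTypes_H2)
    (hX : SimAlgAt[(c : ℂ)]) (M : Module.End ℂ (K3Index → ℂ))
    (hMrat : ∀ v : K3Index → ℤ, ∃ w : K3Index → ℚ, M (fun i => (v i : ℂ)) = fun i => (w i : ℂ))
    (hMc : ∀ a b, k3Form (M a) (M b) = (c : ℂ) * k3Form a b) : TwinTransportFor[M] := by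
  intro μ hμ S S' hS hS' η p x η' p' x' hm hx hm' hx' hper
  have hp'0 : p' ≠ 0 := generator_ne_zero hS' hm'.2.1
  have hc0 : (c : ℂ) ≠ 0 := by exact_mod_cast hc
  obtain ⟨γ, hγ, hγeq⟩ := hX μ hμ S S' hS hS' p p' ⟨hm.1, hm.2.1⟩ ⟨hm'.1, hm'.2.1⟩
    (η.symm.toLinearMap ∘ₗ M ∘ₗ η'.toLinearMap)
    (fun y hy => isRationalClass_markingConj η η' M hS hS' hm.2.2.1 hm'.2.2.1 hMrat hy)
    (fun i j y hy => isOfHodgeType_markingConj η p x η' p' x' M hHT hS hS' hm.2.2.1 hm.2.2.2.1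
      hm.2.2.2.2.1 hx.2.1 hm'.2.2.1 hm'.2.2.2.1 hp'0 hm'.2.2.2.2.1 hx'.2.1 hMrat hc0 hMc
      hper i j y hy)
    (fun y z a h => cupProduct_markingConj η p η' p' M hp'0 hm.2.2.2.1 hm'.2.2.2.1 hMc y z a h)
  exact ⟨γ, hγ, fun y => hγeq y⟩

end Summit.HodgeConjecture.HodgeConjecture.Theorems.NikulinTwinTransport

end
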